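import Summits.BirchSwinnertonDyer.BirchSwinnertonDyer.Theorems.Rank1ResidualJetCarrierNeShaKernel
import Summits.BirchSwinnertonDyer.BirchSwinnertonDyer.Theorems.Rank1ResidualJetCarrierEndFormsSwapFinal
import Literature.NumberTheory.EllipticCurves.HeegnerPointsOfConductorOneGaloisConjProofs
import Literature.NumberTheory.EllipticCurves.HeegnerPointsOfConductorOneRationalityProofs
import Literature.NumberTheory.EllipticCurves.CuspFormLFunctionLevelConductorProofs
import HarnessLib

/-!
# T1 JET (cell `bsd-jet`), road K — the class-free JET consumers ⟸ NAMED PRINT ONLY with McCallum 1991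
# Prop. 5.2 (`h52`) ALSO gone: `BSD(E,p)` at a Tamagawa certificate ⟸ {Poitou–Tate for Selmer structures,
# F1, Gross 3.7 (2)} + {Kolyvagin, GZK} (+ modularity in the level forms) — the booked row grammar

HONEST FRAMING (programme file `BSD-LIT2PART-PROGRAMME-v1.md` §HONESTY, verbatim): «no tranche here
proves BSD; ARM L moves the LITERAL column of an r ≤ 1 census into the kernel-proved-modulo-named-print
column; ARM P changes what «named print» is worth.» THEOREMS ONLY (seat `bsd-jet-pv-2`, session g7;
`--supports stmt-BirchSwinnertonDyer-14418`, helper); nothing is booked, 0 classes move (road K is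
DOCUMENTARY; bookings are referee A's). Nothing about any particular curve is asserted.

WHAT. pv-1 g9's `Rank1ResidualJetCarrierNeShaKernel` proves the class-free consumers of the three JET
buckets (`bsdp_of_carrierNeCertificate[_of_five_le]_of_literature`, `bsdp_of_carrierMultCertificate_of_surj_of_literature`,
`bsdp_of_carrierAddCertificate_of_literature`) with the reading binder `hJ` AND McCallum Cor. 5.6 `hMcU`
struck, displaying {`h52` = McCallum 1991 Prop. 5.2, `hPT` (∀ K), `hF1`, `h372`} + {`hKo`, `hrec`, `hD36`,
`hGZK`}. pv-2 g6 struck `h52` in the END FORMS (`jetchevDivisibilityCarrier{Ne,Mult,Add}_of_swapLiterature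
hPT hF1 h372`, p558893; C2 R923 KERNEL). THIS FILE composes the two: §1 the same four consumers with `h52`
fed NOWHERE (`…_of_swapLiterature`), displayed named print = {`hPT` (∀ K), `hF1`, `h372`} + {`hKo`, `hGZK`}
with `hrec` / `hD36` ALSO supplied by the Literature theorems `heegnerPointOfConductor_one_galoisConj_holds` /
`phi_heegnerTau_mem_singularModuliField_holds`; §2 the LEVEL forms in the binder shape of the register rows
(`K` Heegner for a stated level `N`, `P` a Heegner point of level `N`, `q ∣ N`; `N = N_E` by Carayol from
modularity `hmod : exists_isNewformOf`). This is the booked grammar (index line `ord_p [E(K):ℤP] ≤ w` on an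
abstract Heegner point; Kolyvagin's theorem `hKo` is what makes it bite); the sibling
`Rank1ResidualJetCarrierNeIndexKernel` / `…CarrierPIndexKernel` give the Kolyvagin-free door on the
index-finiteness line. References: [cite: Jetchev2008, Thm. 1.4, Cor. 1.5 (p. 812)] [cite: GrossLMS1991,
Thm. 1.3, Prop. 3.7 (2), §10] [cite: GrossZagier1986, III (3.1)] [cite: MilneADT2006, Ch. I, Thm. 4.10(b)]
[cite: DiamondShurman2005, Thm. 8.8.1]. Design: no definitions; `K : Type`. Axioms: `propext`,
`Classical.choice`, `Quot.sound`.
-/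

set_option autoImplicit false

noncomputable section

open scoped Classical

open WeierstrassCurve Literature.NumberTheory.EllipticCurves
  Literature.NumberTheory.EllipticCurves.ModularForms Literature.NumberTheory.GaloisCohomology
  Literature.NumberTheory.EllipticCurves.Rank1Residual
  Summit.BirchSwinnertonDyer.Rank1Residual Summit.BirchSwinnertonDyer.Rank1Residual.X11b

namespace Summit.BirchSwinnertonDyer.Rank1Residual.JET

/-! ### §1 The three buckets' class-free consumers ⟸ {PT, F1, Gross 3.7 (2)} + {Kolyvagin, GZK} -/

/-- **Bucket A (`q ≠ p`), `BSD(E,p)` ⟸ named print only, NO McCallum 5.2**: pv-1's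
`noPTorsion_of_carrierNeCertificate_of_divisibility` fed with road K's `h52`-free END FORM
`jetchevDivisibilityCarrierNe_of_swapLiterature hPT hF1 h372`, Poitou–Tate (sum form) from `hPT K`,
[McC] 4.4 from (A′), `hrec`/`hD36` from the Literature theorems. Displayed named print: {`hPT` (∀ K),
`hF1`, `h372`, `hKo`, `hGZK`}. [cite: Jetchev2008, Cor. 1.5 (p. 812), Thm. 1.4]
[cite: GrossLMS1991, Thm. 1.3, Prop. 3.7 (2)] [cite: Miller2011LMS, Def. 1.1] -/
theorem bsdp_of_carrierNeCertificate_of_swapLiterature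
    (hPT : ∀ (K : Type) [Field K] [NumberField K], poitouTate_selmerStructure_duality_conj K)
    (hF1 : Gross1991_heegnerPoint_sub_ratTorsion_mem_E0)
    (h372 : GrossLMS1991.prop37_2_frobeniusCongruence)
    (hGZK : rank_eq_analyticRank_of_analyticRank_le_one)
    (W : WeierstrassCurve ℚ) [W.IsElliptic] [W.IsGloballyMinimal] [NeZero (W.conductorNorm ℤ)]
    (K : Type) [Field K] [NumberField K] (hKo : kolyvagin (W.conductorNorm ℤ) W K)
    (hK : IsImaginaryQuadratic K)
    (hD3 : NumberField.discr K ≠ -3) (hD4 : NumberField.discr K ≠ -4)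
    (hH : SatisfiesHeegnerHypothesis (W.conductorNorm ℤ) K)
    (p : ℕ) [Fact p.Prime] (hp2 : p ≠ 2)
    (htower : ∀ n : ℕ, W.HasSurjectiveModNGaloisRep (p ^ n : ℕ))
    {P : (W.baseChange K).toAffine.Point} (hP : IsHeegnerPoint (W.conductorNorm ℤ) W K P)
    (hnt : ¬ IsOfFinAddOrder P)
    (q : ℕ) [Fact q.Prime] (hq : q ∣ W.conductorNorm ℤ) (hqp : q ≠ p)
    (hI : padicValNat p (AddSubgroup.zmultiples P).index ≤
      padicValNat p ((W.baseChange ℚ_[q]).localTamagawaNumber ℤ_[q]))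
    (hr : W.analyticRank ≤ 1) {s : ℚ} (hs : shaAn W = (s : ℂ)) (hv : padicValRat p s = 0) :
    BSDp W p :=
  Typed.bsdp_of_shaAn_unit_of_noPTorsion W p hGZK hr hs hv
    (noPTorsion_of_carrierNeCertificate_of_divisibility
      (jetchevDivisibilityCarrierNe_of_swapLiterature hPT hF1 h372) W K
      (poitouTate_sum_of_selmerStructure_conj (hPT K)) (prop44_of_frobeniusCongruence h372) hF1 hKo
      (heegnerPointOfConductor_one_galoisConj_holds (W.conductorNorm ℤ) W K)
      (phi_heegnerTau_mem_singularModuliField_holds (W.conductorNorm ℤ) W K) hK hD3 hD4 hH p hp2 htower hP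
      hnt q hq hqp hI)

/-- **Bucket A, `p ≥ 5`, ⟸ named print only, NO McCallum 5.2**: the tower from `ρ̄_{E,p}` onto (Serre,
`serre_hasSurjectiveModNGaloisRep_pow_holds`). Displayed: {`hPT` (∀ K), `hF1`, `h372`, `hKo`, `hGZK`}.
[cite: Jetchev2008, Cor. 1.5 (p. 812)] [cite: SerreAbelianLadic1968, Ch. IV §3.4 Lemma 3] -/
theorem bsdp_of_carrierNeCertificate_of_five_le_of_swapLiterature
    (hPT : ∀ (K : Type) [Field K] [NumberField K], poitouTate_selmerStructure_duality_conj K)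
    (hF1 : Gross1991_heegnerPoint_sub_ratTorsion_mem_E0)
    (h372 : GrossLMS1991.prop37_2_frobeniusCongruence)
    (hGZK : rank_eq_analyticRank_of_analyticRank_le_one)
    (W : WeierstrassCurve ℚ) [W.IsElliptic] [W.IsGloballyMinimal] [NeZero (W.conductorNorm ℤ)]
    (K : Type) [Field K] [NumberField K] (hKo : kolyvagin (W.conductorNorm ℤ) W K)
    (hK : IsImaginaryQuadratic K)
    (hD3 : NumberField.discr K ≠ -3) (hD4 : NumberField.discr K ≠ -4)
    (hH : SatisfiesHeegnerHypothesis (W.conductorNorm ℤ) K)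
    (p : ℕ) [Fact p.Prime] (h5 : 5 ≤ p) (hsurj : W.HasSurjectiveModNGaloisRep p)
    {P : (W.baseChange K).toAffine.Point} (hP : IsHeegnerPoint (W.conductorNorm ℤ) W K P)
    (hnt : ¬ IsOfFinAddOrder P)
    (q : ℕ) [Fact q.Prime] (hq : q ∣ W.conductorNorm ℤ) (hqp : q ≠ p)
    (hI : padicValNat p (AddSubgroup.zmultiples P).index ≤
      padicValNat p ((W.baseChange ℚ_[q]).localTamagawaNumber ℤ_[q]))
    (hr : W.analyticRank ≤ 1) {s : ℚ} (hs : shaAn W = (s : ℂ)) (hv : padicValRat p s = 0) :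
    BSDp W p := by
  have hp2 : p ≠ 2 := by omega
  exact bsdp_of_carrierNeCertificate_of_swapLiterature hPT hF1 h372 hGZK W K hKo hK hD3 hD4 hH p hp2
    (serre_hasSurjectiveModNGaloisRep_pow_holds W p h5 hsurj) hP hnt q hq hqp hI hr hs hv

/-- **Bucket B multiplicative (`q = p`, `p` odd multiplicative, `ρ̄_{E,p}` onto) ⟸ named print only,
NO McCallum 5.2**: pv-1's core `noPTorsion_of_heegnerCertificate_of_divisibility` with K3 fed by
`jetchevDivisibilityCarrierMult_of_swapLiterature hPT hF1 h372`; the tower from mod-`p` surjectivity at a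
multiplicative prime (`forall_hasSurjectiveModNGaloisRep_pow_of_multiplicative_of_surj`). Displayed:
{`hPT` (∀ K), `hF1`, `h372`, `hKo`, `hGZK`}. [cite: Jetchev2008, Cor. 1.5 (p. 812), Thm. 1.4]
[cite: Wuthrich2014, Lemma 20 (p. 399)] [cite: Miller2011LMS, Def. 1.1] -/
theorem bsdp_of_carrierMultCertificate_of_surj_of_swapLiterature
    (hPT : ∀ (K : Type) [Field K] [NumberField K], poitouTate_selmerStructure_duality_conj K)
    (hF1 : Gross1991_heegnerPoint_sub_ratTorsion_mem_E0)
    (h372 : GrossLMS1991.prop37_2_frobeniusCongruence)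
    (hGZK : rank_eq_analyticRank_of_analyticRank_le_one)
    (W : WeierstrassCurve ℚ) [W.IsElliptic] [W.IsGloballyMinimal] [NeZero (W.conductorNorm ℤ)]
    (K : Type) [Field K] [NumberField K] (hKo : kolyvagin (W.conductorNorm ℤ) W K)
    (hK : IsImaginaryQuadratic K) (hD3 : NumberField.discr K ≠ -3) (hD4 : NumberField.discr K ≠ -4)
    (hH : SatisfiesHeegnerHypothesis (W.conductorNorm ℤ) K)
    (p : ℕ) [Fact p.Prime] (hp2 : p ≠ 2) (hmult : W.HasMultiplicativeReductionAtPrime p)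
    (hsurj : W.HasSurjectiveModNGaloisRep p)
    {P : (W.baseChange K).toAffine.Point} (hP : IsHeegnerPoint (W.conductorNorm ℤ) W K P)
    (hnt : ¬ IsOfFinAddOrder P)
    (hI : padicValNat p (AddSubgroup.zmultiples P).index ≤
      padicValNat p ((W.baseChange ℚ_[p]).localTamagawaNumber ℤ_[p]))
    (hr : W.analyticRank ≤ 1) {s : ℚ} (hs : shaAn W = (s : ℂ)) (hv : padicValRat p s = 0) :
    BSDp W p := by
  have hcm : ¬ W.HasCM := not_hasCM_of_hasMultiplicativeReductionAtPrime' W hmult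
  have htower : ∀ n : ℕ, W.HasSurjectiveModNGaloisRep (p ^ n : ℕ) := fun n ↦
    W.forall_hasSurjectiveModNGaloisRep_pow_of_multiplicative_of_surj p hp2 hmult hsurj n
  have hJ : JetchevDivisibilityCarrierMult := jetchevDivisibilityCarrierMult_of_swapLiterature hPT hF1 h372
  exact Typed.bsdp_of_shaAn_unit_of_noPTorsion W p hGZK hr hs hv
    (noPTorsion_of_heegnerCertificate_of_divisibility W hcm K (poitouTate_sum_of_selmerStructure_conj (hPT K))
      (prop44_of_frobeniusCongruence h372) hF1 hKo
      (heegnerPointOfConductor_one_galoisConj_holds (W.conductorNorm ℤ) W K)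
      (phi_heegnerTau_mem_singularModuliField_holds (W.conductorNorm ℤ) W K) hK hD3 hD4 hH p hp2 htower hP
      hnt _
      (fun Dt β ι d₁ hy₁ s hs n d hn hℓ ↦ hJ W hcm K hK hD3 hD4 hH p hp2 hmult htower Dt β ι d₁ hy₁ s hs
        n d hn hℓ) hI)

/-- **Bucket B additive (`q = p`, `p` odd, `E` neither good nor multiplicative at `p`, `p`-adic tower
onto) ⟸ named print only, NO McCallum 5.2**: K4 fed by `jetchevDivisibilityCarrierAdd_of_swapLiterature
hPT hF1 h372`. Displayed: {`hPT` (∀ K), `hF1`, `h372`, `hKo`, `hGZK`}. [cite: Jetchev2008, Cor. 1.5 (p. 812), Thm. 1.4]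
[cite: Miller2011LMS, Def. 1.1] -/
theorem bsdp_of_carrierAddCertificate_of_swapLiterature
    (hPT : ∀ (K : Type) [Field K] [NumberField K], poitouTate_selmerStructure_duality_conj K)
    (hF1 : Gross1991_heegnerPoint_sub_ratTorsion_mem_E0)
    (h372 : GrossLMS1991.prop37_2_frobeniusCongruence)
    (hGZK : rank_eq_analyticRank_of_analyticRank_le_one)
    (W : WeierstrassCurve ℚ) [W.IsElliptic] [W.IsGloballyMinimal] [NeZero (W.conductorNorm ℤ)]
    (K : Type) [Field K] [NumberField K] (hKo : kolyvagin (W.conductorNorm ℤ) W K)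
    (hK : IsImaginaryQuadratic K) (hD3 : NumberField.discr K ≠ -3) (hD4 : NumberField.discr K ≠ -4)
    (hH : SatisfiesHeegnerHypothesis (W.conductorNorm ℤ) K)
    (p : ℕ) [Fact p.Prime] (hp2 : p ≠ 2) (hng : ¬ W.HasGoodReductionAtPrime p)
    (hnm : ¬ W.HasMultiplicativeReductionAtPrime p)
    (htower : ∀ n : ℕ, W.HasSurjectiveModNGaloisRep (p ^ n : ℕ))
    {P : (W.baseChange K).toAffine.Point} (hP : IsHeegnerPoint (W.conductorNorm ℤ) W K P)
    (hnt : ¬ IsOfFinAddOrder P)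
    (hI : padicValNat p (AddSubgroup.zmultiples P).index ≤
      padicValNat p ((W.baseChange ℚ_[p]).localTamagawaNumber ℤ_[p]))
    (hr : W.analyticRank ≤ 1) {s : ℚ} (hs : shaAn W = (s : ℂ)) (hv : padicValRat p s = 0) :
    BSDp W p := by
  have hsurj : W.HasSurjectiveModNGaloisRep (p : ℤ) := by simpa using htower 1
  have hcm : ¬ W.HasCM := fun hCM ↦
    W.not_hasSurjectiveModNGaloisRep_of_hasCM hCM (Fact.out : p.Prime) hp2 (by simpa using hsurj)
  have hJ : JetchevDivisibilityCarrierAdd := jetchevDivisibilityCarrierAdd_of_swapLiterature hPT hF1 h372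
  exact Typed.bsdp_of_shaAn_unit_of_noPTorsion W p hGZK hr hs hv
    (noPTorsion_of_heegnerCertificate_of_divisibility W hcm K (poitouTate_sum_of_selmerStructure_conj (hPT K))
      (prop44_of_frobeniusCongruence h372) hF1 hKo
      (heegnerPointOfConductor_one_galoisConj_holds (W.conductorNorm ℤ) W K)
      (phi_heegnerTau_mem_singularModuliField_holds (W.conductorNorm ℤ) W K) hK hD3 hD4 hH p hp2 htower hP
      hnt _
      (fun Dt β ι d₁ hy₁ s hs n d hn hℓ ↦ hJ W hcm K hK hD3 hD4 hH p hp2 hng hnm htower Dt β ι d₁ hy₁ s hs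
        n d hn hℓ) hI)

/-! ### §2 LEVEL forms — the binder shape of the register rows (`hKo ∀`, Carayol from modularity) -/

/-- **Bucket A at a Heegner datum of any stated level `N` ⟸ named print only** (`p` odd, tower onto):
the register rows' shape (`JET.bsdp_of_carrierNeCertificate_level`), `N = N_E` by Carayol from
modularity `hmod` (`IsNewformOf.level_eq_conductorNorm_of_exists_isNewformOf'`). Displayed named print:
{`hPT` (∀ K), `hF1`, `h372`, `hKo` (∀), `hGZK`, `hmod`}. [cite: Jetchev2008, Cor. 1.5 (p. 812)]
[cite: DiamondShurman2005, Thm. 8.8.1] -/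
theorem bsdp_of_carrierNeCertificate_level_of_swapLiterature
    (hPT : ∀ (K : Type) [Field K] [NumberField K], poitouTate_selmerStructure_duality_conj K)
    (hF1 : Gross1991_heegnerPoint_sub_ratTorsion_mem_E0)
    (h372 : GrossLMS1991.prop37_2_frobeniusCongruence)
    (hGZK : rank_eq_analyticRank_of_analyticRank_le_one)
    (hKo : ∀ (N : ℕ) [NeZero N] (W : WeierstrassCurve ℚ) (K : Type) [Field K] [NumberField K],
      kolyvagin N W K)
    (hmod : exists_isNewformOf)
    (W : WeierstrassCurve ℚ) [W.IsElliptic] [W.IsGloballyMinimal] (p : ℕ) [Fact p.Prime]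
    {N : ℕ} [NeZero N] {K : Type} [Field K] [NumberField K] (hK : IsImaginaryQuadratic K)
    (hD3 : NumberField.discr K ≠ -3) (hD4 : NumberField.discr K ≠ -4)
    (hH : SatisfiesHeegnerHypothesis N K) {P : (W.baseChange K).toAffine.Point}
    (hP : IsHeegnerPoint N W K P) (hnt : ¬ IsOfFinAddOrder P)
    (hp2 : p ≠ 2) (htower : ∀ n : ℕ, W.HasSurjectiveModNGaloisRep (p ^ n : ℕ))
    (q : ℕ) [Fact q.Prime] (hqN : q ∣ N) (hqp : q ≠ p)
    (hI : padicValNat p (AddSubgroup.zmultiples P).index ≤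
      padicValNat p ((W.baseChange ℚ_[q]).localTamagawaNumber ℤ_[q]))
    (hr : W.analyticRank ≤ 1) {s : ℚ} (hs : shaAn W = (s : ℂ)) (hv : padicValRat p s = 0) :
    BSDp W p := by
  obtain ⟨Dt, -, -, -⟩ := id hP
  have hN : N = W.conductorNorm ℤ := IsNewformOf.level_eq_conductorNorm_of_exists_isNewformOf' hmod Dt.isNewformOf
  subst hN
  exact bsdp_of_carrierNeCertificate_of_swapLiterature hPT hF1 h372 hGZK W K (hKo _ W K) hK hD3 hD4 hH p hp2
    htower hP hnt q hqN hqp hI hr hs hv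

/-- **Bucket A, `p ≥ 5`, level form ⟸ named print only** — the shape of the register's road S
(`JET.bsdp_of_jetRowA5_tam_min` ⟶ `JET.bsdp_of_carrierNeCertificate_level_of_five_le`).
[cite: Jetchev2008, Cor. 1.5 (p. 812)] [cite: SerreAbelianLadic1968, Ch. IV §3.4 Lemma 3] -/
theorem bsdp_of_carrierNeCertificate_level_of_five_le_of_swapLiterature
    (hPT : ∀ (K : Type) [Field K] [NumberField K], poitouTate_selmerStructure_duality_conj K)
    (hF1 : Gross1991_heegnerPoint_sub_ratTorsion_mem_E0)
    (h372 : GrossLMS1991.prop37_2_frobeniusCongruence)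
    (hGZK : rank_eq_analyticRank_of_analyticRank_le_one)
    (hKo : ∀ (N : ℕ) [NeZero N] (W : WeierstrassCurve ℚ) (K : Type) [Field K] [NumberField K],
      kolyvagin N W K)
    (hmod : exists_isNewformOf)
    (W : WeierstrassCurve ℚ) [W.IsElliptic] [W.IsGloballyMinimal] (p : ℕ) [Fact p.Prime]
    {N : ℕ} [NeZero N] {K : Type} [Field K] [NumberField K] (hK : IsImaginaryQuadratic K)
    (hD3 : NumberField.discr K ≠ -3) (hD4 : NumberField.discr K ≠ -4)
    (hH : SatisfiesHeegnerHypothesis N K) {P : (W.baseChange K).toAffine.Point}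
    (hP : IsHeegnerPoint N W K P) (hnt : ¬ IsOfFinAddOrder P)
    (h5 : 5 ≤ p) (hsurj : W.HasSurjectiveModNGaloisRep p)
    (q : ℕ) [Fact q.Prime] (hqN : q ∣ N) (hqp : q ≠ p)
    (hI : padicValNat p (AddSubgroup.zmultiples P).index ≤
      padicValNat p ((W.baseChange ℚ_[q]).localTamagawaNumber ℤ_[q]))
    (hr : W.analyticRank ≤ 1) {s : ℚ} (hs : shaAn W = (s : ℂ)) (hv : padicValRat p s = 0) :
    BSDp W p := by
  have hp2 : p ≠ 2 := by omega
  exact bsdp_of_carrierNeCertificate_level_of_swapLiterature hPT hF1 h372 hGZK hKo hmod W p hK hD3 hD4 hH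
    hP hnt hp2 (serre_hasSurjectiveModNGaloisRep_pow_holds W p h5 hsurj) q hqN hqp hI hr hs hv

/-- **Bucket B multiplicative, level form ⟸ named print only** (the shape of
`JET.bsdp_of_carrierMultCertificate_level_of_surj`). [cite: Jetchev2008, Cor. 1.5 (p. 812)]
[cite: DiamondShurman2005, Thm. 8.8.1] [cite: Wuthrich2014, Lemma 20 (p. 399)] -/
theorem bsdp_of_carrierMultCertificate_level_of_surj_of_swapLiterature
    (hPT : ∀ (K : Type) [Field K] [NumberField K], poitouTate_selmerStructure_duality_conj K)
    (hF1 : Gross1991_heegnerPoint_sub_ratTorsion_mem_E0)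
    (h372 : GrossLMS1991.prop37_2_frobeniusCongruence)
    (hGZK : rank_eq_analyticRank_of_analyticRank_le_one)
    (hKo : ∀ (N : ℕ) [NeZero N] (W : WeierstrassCurve ℚ) (K : Type) [Field K] [NumberField K],
      kolyvagin N W K)
    (hmod : exists_isNewformOf)
    (W : WeierstrassCurve ℚ) [W.IsElliptic] [W.IsGloballyMinimal] (p : ℕ) [Fact p.Prime]
    {N : ℕ} [NeZero N] {K : Type} [Field K] [NumberField K] (hK : IsImaginaryQuadratic K)
    (hD3 : NumberField.discr K ≠ -3) (hD4 : NumberField.discr K ≠ -4)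
    (hH : SatisfiesHeegnerHypothesis N K) {P : (W.baseChange K).toAffine.Point}
    (hP : IsHeegnerPoint N W K P) (hnt : ¬ IsOfFinAddOrder P)
    (hp2 : p ≠ 2) (hmult : W.HasMultiplicativeReductionAtPrime p) (hsurj : W.HasSurjectiveModNGaloisRep p)
    (hI : padicValNat p (AddSubgroup.zmultiples P).index ≤
      padicValNat p ((W.baseChange ℚ_[p]).localTamagawaNumber ℤ_[p]))
    (hr : W.analyticRank ≤ 1) {s : ℚ} (hs : shaAn W = (s : ℂ)) (hv : padicValRat p s = 0) :
    BSDp W p := by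
  obtain ⟨Dt, -, -, -⟩ := id hP
  have hN : N = W.conductorNorm ℤ := IsNewformOf.level_eq_conductorNorm_of_exists_isNewformOf' hmod Dt.isNewformOf
  subst hN
  exact bsdp_of_carrierMultCertificate_of_surj_of_swapLiterature hPT hF1 h372 hGZK W K (hKo _ W K) hK hD3 hD4 hH
    p hp2 hmult hsurj hP hnt hI hr hs hv

/-- **Bucket B additive, level form ⟸ named print only** (the shape of `JET.bsdp_of_carrierAddCertificate_level`;
the tower stays a binder — mod-9 Frobenius certificate at `p = 3`, Serre at `p ≥ 5`).
[cite: Jetchev2008, Cor. 1.5 (p. 812)] [cite: DiamondShurman2005, Thm. 8.8.1] -/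
theorem bsdp_of_carrierAddCertificate_level_of_swapLiterature
    (hPT : ∀ (K : Type) [Field K] [NumberField K], poitouTate_selmerStructure_duality_conj K)
    (hF1 : Gross1991_heegnerPoint_sub_ratTorsion_mem_E0)
    (h372 : GrossLMS1991.prop37_2_frobeniusCongruence)
    (hGZK : rank_eq_analyticRank_of_analyticRank_le_one)
    (hKo : ∀ (N : ℕ) [NeZero N] (W : WeierstrassCurve ℚ) (K : Type) [Field K] [NumberField K],
      kolyvagin N W K)
    (hmod : exists_isNewformOf)
    (W : WeierstrassCurve ℚ) [W.IsElliptic] [W.IsGloballyMinimal] (p : ℕ) [Fact p.Prime]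
    {N : ℕ} [NeZero N] {K : Type} [Field K] [NumberField K] (hK : IsImaginaryQuadratic K)
    (hD3 : NumberField.discr K ≠ -3) (hD4 : NumberField.discr K ≠ -4)
    (hH : SatisfiesHeegnerHypothesis N K) {P : (W.baseChange K).toAffine.Point}
    (hP : IsHeegnerPoint N W K P) (hnt : ¬ IsOfFinAddOrder P)
    (hp2 : p ≠ 2) (hng : ¬ W.HasGoodReductionAtPrime p) (hnm : ¬ W.HasMultiplicativeReductionAtPrime p)
    (htower : ∀ n : ℕ, W.HasSurjectiveModNGaloisRep (p ^ n : ℕ))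
    (hI : padicValNat p (AddSubgroup.zmultiples P).index ≤
      padicValNat p ((W.baseChange ℚ_[p]).localTamagawaNumber ℤ_[p]))
    (hr : W.analyticRank ≤ 1) {s : ℚ} (hs : shaAn W = (s : ℂ)) (hv : padicValRat p s = 0) :
    BSDp W p := by
  obtain ⟨Dt, -, -, -⟩ := id hP
  have hN : N = W.conductorNorm ℤ := IsNewformOf.level_eq_conductorNorm_of_exists_isNewformOf' hmod Dt.isNewformOf
  subst hN
  exact bsdp_of_carrierAddCertificate_of_swapLiterature hPT hF1 h372 hGZK W K (hKo _ W K) hK hD3 hD4 hH p hp2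
    hng hnm htower hP hnt hI hr hs hv

end Summit.BirchSwinnertonDyer.Rank1Residual.JET

end
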